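import Summits.Ventures.LatticeQCDFlow.Scaling.SimulatedTemperingDiffusive
import Summits.Ventures.LatticeQCDFlow.TrivializingMaps.SpecificHeatFloorTwoDim
import Summits.Ventures.LatticeQCDFlow.TrivializingMaps.StrongCouplingSpecificHeat
import Summits.Ventures.LatticeQCDFlow.TrivializingMaps.HaarTraceMomentsSUn
import Summits.Ventures.LatticeQCDFlow.TrivializingMaps.WilsonSU2FisherZeroRadius
import Summits.Ventures.LatticeQCDFlow.Scaling.DefectSwapAcceptance

/-!
HONEST FRAMING: exact (Metropolis-corrected) sampling algorithms for lattice gauge theory; figures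
of merit are autocorrelation/cost numbers at stated couplings and volumes; no continuum-physics
claim.

# SimulatedTemperingDiffusiveInstances — THE DIFFUSIVE LAW OF SIMULATED TEMPERING WITH REALISTIC CONSTANTS:
# IN TWO DIMENSIONS AT EVERY COUPLING (EVERY COMPACT GAUGE GROUP), FOR `SU(n)` AT STRONG COUPLING IN EVERY
# DIMENSION (`1 − ρ_level(1) = O(1/(#plaq·(b−a)²))`), AND FOR TEMPERING IN THE BOUNDARY CONDITION
# (`1 − ρ_level(1) = O(1/(#D·(b−a)²))`), UNIFORMLY IN THE NUMBER OF LEVELS (lean-2 GEN-13, ours)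

Venture-side (OURS).  Cell `lqcd-flow` (pub-lqcd), unit `pub-lqcd-lean-2-g13`, 2026-08-23.  The ladder-size-free
law `Scaling/SimulatedTemperingDiffusive.st_level_lagOneAutocorr_ge_kfree` (`1 − 96/(e·m·(b−a)²) ≤ ρ_lev(1)` for
every exact simulated-tempering kernel with nearest-neighbour Metropolis-dominated level moves over the uniform
ladder from `a` to `b`, `m` a variance floor of `X` on `[a, b]`) docked to the two specific-heat floors of the tree
whose constants are realistic (the all-coupling docking of `SimulatedTemperingDiffusive` inherits GEN-9's
structural `e^{−βc}`):

* **`wilson_st_level_lagOneAutocorr_ge_twoDim`** — `d = 2`, every compact `G`, continuous `ρ`, every `L ≥ 2`,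
  every window `−B ≤ a < b ≤ B` with `m₂ = e^{−4NB}(L²−1)·Var_Haar(Re tr ρ)/2 − N² > 0` (GEN-12's pinched 2-d floor
  `TrivializingMaps/SpecificHeatFloorTwoDim.wilson_variance_ge_twoDim`): `1 − 96/(e·m₂·(b−a)²) ≤ ρ_lev(1)` —
  `1 − ρ_lev(1) = O(e^{4NB}/(L²(b−a)²))` for every number of levels and every within-level algorithm;
* **`wilson_st_level_lagOneAutocorr_ge_sun_strongCoupling`** — `SU(n)`, `n ≥ 3`, every `d ≥ 2`, `L ≥ 2`, every
  window inside the Kotecký–Preiss strong-coupling radius (`|a|, |b| ≤ min(r/8, r³/1024)`,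
  `r = 1/(8e·n·(3^d d² + 1)²)`; GEN-8's `TrivializingMaps/StrongCouplingSpecificHeat.wilson_variance_ge_half_strongCoupling`
  with `∫ (Re tr)² dHaar = ½`, `TrivializingMaps/HaarTraceMomentsSUn.haarSqReTrace_eq_half`):
  `1 − 384/(e·#plaq·(b−a)²) ≤ ρ_lev(1)`.

* **`defect_st_level_lagOneAutocorr_ge`** — tempering in the BOUNDARY CONDITION: the defect family
  `μ_{β,u} ∝ exp(−βS_{Dᶜ} − uS_D) dU` (`Scaling/DefectSwapAcceptance`, every compact `G`, `Var_Haar(Re tr ρ) > 0`,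
  `L ≥ 2`, `#D ≥ 1`, `|β| ≤ B`, window `−B ≤ a < b ≤ B`): with lean-1's defect specific-heat floor
  `m_D = e^{−8N(d−1)B}·(#D/(8d(d−1)+1))·Var_Haar(Re tr ρ)`, `1 − 96/(e·m_D·(b−a)²) ≤ ρ_lev(1)` for every exact
  simulated-tempering kernel over the uniform defect-coupling ladder — `Ω(#D·(b−a)²)` level updates per
  decorrelation of the boundary condition (the single-copy variant of PTBC; the parallel variant's tagged replica
  is NOT typed).

* **`wilson_st_level_lagOneAutocorr_ge_su2_strongCoupling`** — `SU(2)` (`∫(Re tr)² = 1`, `haarSqReTrace_su2`):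
  `1 − 192/(e·#plaq·(b−a)²) ≤ ρ_lev(1)` inside its Kotecký–Preiss window.

Reading (no numerics implied): in the STEP-0 dimension and in the strong-coupling window of `SU(3)` the level of
an exact simulated-tempering run decorrelates no faster than `1 − ρ_lev(1) ≤ C/(#plaq·(b−a)²)` with an ORDER-ONE
`C` (`384/e ≈ 141` for `SU(n ≥ 3)` at strong coupling): `Ω(#plaq·(b−a)²)` level updates per decorrelation,
uniformly in the ladder.  NOT CLAIMED: `d ≥ 3` outside the strong-coupling radius with a realistic constant;
anything measured.  Literature grade (cell
rule): KNOWN MECHANISM (diffusive tempering; `√C_V` level spacing), NEW TYPING; nothing cited as a fact.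
-/

noncomputable section

open MeasureTheory ProbabilityTheory Set Filter Finset
open Literature.MathematicalPhysics.QuantumFieldTheory
open Literature.MathematicalPhysics.QuantumFieldTheory.Luscher2010
open Summit.Ventures.LatticeQCDFlow.Scoring
open Summit.Ventures.LatticeQCDFlow.TrivializingMaps
open scoped ENNReal

namespace Summit.Ventures.LatticeQCDFlow.Scaling

/-! ## §1 Two dimensions, every compact gauge group, every coupling -/

section TwoDim

variable {L N : ℕ} [NeZero L] {G : Type*} [Group G] [TopologicalSpace G] [IsTopologicalGroup G]
  [CompactSpace G] [MeasurableSpace G] [BorelSpace G] [SecondCountableTopology G]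
  (ρ : G →* Matrix (Fin N) (Fin N) ℂ)

/-- **SIMULATED TEMPERING IN THE COUPLING IS DIFFUSIVE IN TWO DIMENSIONS, WITH THE PINCHED CONSTANT** (`d = 2`,
every compact `G`, continuous `ρ`, `L ≥ 2`, `−B ≤ a < b ≤ B`, `K ≥ 1`,
`m₂ := e^{−4NB}·(L²−1)·Var_Haar(Re tr ρ)/2 − N² > 0`).  For EVERY Markov kernel on `Fin (K+1) × G^E` leaving the
exact-weight simulated-tempering target over the uniform ladder from `a` to `b` invariant, with nearest-neighbour
level moves dominated by the exact-weight Metropolis ratios: `1 − 96/(e·m₂·(b−a)²) ≤ ρ_lev(1)`. [ours] -/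
theorem wilson_st_level_lagOneAutocorr_ge_twoDim (hL : 2 ≤ L) (hρ : Continuous ρ) {a b B : ℝ} (ha : -B ≤ a)
    (hab : a < b) (hb : b ≤ B)
    (hm : 0 < Real.exp (-(4 * N * B)) * ((L : ℝ) ^ 2 - 1) *
      variance (fun g : G => (ρ g).trace.re) (haarProbability G) / 2 - (N : ℝ) ^ 2)
    {K : ℕ} (hK : 1 ≤ K)
    (κ : Kernel (Fin (K + 1) × GaugeConfig 2 L G) (Fin (K + 1) × GaugeConfig 2 L G)) [IsMarkovKernel κ]
    (hinv : Kernel.Invariant κ (stTarget (fun U => -wilsonAction ρ U) (trivialMeasure G 2 L)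
      (fun k => a + k * ((b - a) / K)) K))
    (hnn : ∀ z, ∀ᵐ y ∂(κ z), |(((y.1 : Fin (K + 1)) : ℕ) : ℝ) - ((z.1 : Fin (K + 1)) : ℕ)| ≤ 1)
    (hup : ∀ (k : Fin (K + 1)) (U : GaugeConfig 2 L G), (k : ℕ) < K →
      (κ (k, U)).real {y | ((y.1 : Fin (K + 1)) : ℕ) = (k : ℕ) + 1} ≤
        min 1 ((Real.exp ((a + (((k : ℕ) + 1 : ℕ) : ℝ) * ((b - a) / K)) * (-wilsonAction ρ U)) /
            mgf (fun U => -wilsonAction ρ U) (trivialMeasure G 2 L) (a + (((k : ℕ) + 1 : ℕ) : ℝ) * ((b - a) / K))) /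
          (Real.exp ((a + ((k : ℕ) : ℝ) * ((b - a) / K)) * (-wilsonAction ρ U)) /
            mgf (fun U => -wilsonAction ρ U) (trivialMeasure G 2 L) (a + ((k : ℕ) : ℝ) * ((b - a) / K)))))
    (hdown : ∀ (k : Fin (K + 1)) (U : GaugeConfig 2 L G), 1 ≤ (k : ℕ) →
      (κ (k, U)).real {y | ((y.1 : Fin (K + 1)) : ℕ) + 1 = (k : ℕ)} ≤
        min 1 ((Real.exp ((a + (((k : ℕ) - 1 : ℕ) : ℝ) * ((b - a) / K)) * (-wilsonAction ρ U)) /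
            mgf (fun U => -wilsonAction ρ U) (trivialMeasure G 2 L) (a + (((k : ℕ) - 1 : ℕ) : ℝ) * ((b - a) / K))) /
          (Real.exp ((a + ((k : ℕ) : ℝ) * ((b - a) / K)) * (-wilsonAction ρ U)) /
            mgf (fun U => -wilsonAction ρ U) (trivialMeasure G 2 L) (a + ((k : ℕ) : ℝ) * ((b - a) / K))))) :
    1 - 96 / (Real.exp 1 * (Real.exp (-(4 * N * B)) * ((L : ℝ) ^ 2 - 1) *
        variance (fun g : G => (ρ g).trace.re) (haarProbability G) / 2 - (N : ℝ) ^ 2) * (b - a) ^ 2) ≤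
      (autocov κ (stTarget (fun U => -wilsonAction ρ U) (trivialMeasure G 2 L)
            (fun k => a + k * ((b - a) / K)) K)
          (fun z => (((z.1 : Fin (K + 1)) : ℕ) : ℝ)) 1 - ((K : ℝ) / 2) ^ 2) / (K * (K + 2) / 12) := by
  haveI : IsProbabilityMeasure (trivialMeasure G 2 L) := trivialMeasure_isProbabilityMeasure
  have hL1 : (0 : ℝ) ≤ (L : ℝ) ^ 2 - 1 := by
    have : (2 : ℝ) ≤ L := by exact_mod_cast hL
    nlinarith
  have hv : 0 ≤ variance (fun g : G => (ρ g).trace.re) (haarProbability G) := variance_nonneg _ _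
  -- the pinched floor on `[a,b] ⊆ [−B,B]`: `e^{−4N|u|} ≥ e^{−4NB}`
  have hfloor : ∀ u ∈ Icc a b, Real.exp (-(4 * N * B)) * ((L : ℝ) ^ 2 - 1) *
      variance (fun g : G => (ρ g).trace.re) (haarProbability G) / 2 - (N : ℝ) ^ 2 ≤
      variance (fun U => -wilsonAction ρ U) ((trivialMeasure G 2 L).tilted fun U => u * (-wilsonAction ρ U)) := by
    intro u hu
    rw [tilted_neg_wilsonAction_eq ρ hρ u, variance_fun_neg]
    refine le_trans ?_ (wilson_variance_ge_twoDim (L := L) ρ hL hρ u)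
    have hu' : |u| ≤ B := abs_le.2 ⟨by linarith [hu.1], by linarith [hu.2]⟩
    have hexp : Real.exp (-(4 * N * B)) ≤ Real.exp (-(4 * N * |u|)) := by
      apply Real.exp_le_exp.2
      have hN : (0 : ℝ) ≤ N := Nat.cast_nonneg _
      nlinarith
    have := mul_le_mul_of_nonneg_right (mul_le_mul_of_nonneg_right hexp hL1) hv
    linarith
  exact st_level_lagOneAutocorr_ge_kfree (μ := trivialMeasure G 2 L) (measurable_neg_wilsonAction ρ hρ)
    (neg_wilsonAction_bounded ρ hρ) hab hm hfloor hK κ hinv hnn hup hdown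

end TwoDim

/-! ## §2 `SU(n)`, `n ≥ 3`, at strong coupling, every dimension -/

section SUN

variable {d L n : ℕ} [NeZero L]

/-- **SIMULATED TEMPERING IN THE COUPLING IS DIFFUSIVE AT STRONG COUPLING FOR `SU(n)`, `n ≥ 3`, EVERY DIMENSION,
EVERY VOLUME** (`d ≥ 2`, `L ≥ 2`; window `a < b` inside the Kotecký–Preiss radius: `|a|, |b| ≤ min(r/8, r³/1024)`,
`r = 1/(8e·n·(3^d d² + 1)²)`; `K ≥ 1`).  For EVERY Markov kernel on `Fin (K+1) × SU(n)^E` leaving the exact-weight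
simulated-tempering target over the uniform ladder from `a` to `b` invariant, with nearest-neighbour level moves
dominated by the exact-weight Metropolis ratios: `1 − 384/(e·#plaq·(b−a)²) ≤ ρ_lev(1)`. [ours] -/
theorem wilson_st_level_lagOneAutocorr_ge_sun_strongCoupling (hd : 2 ≤ d) (hn : 3 ≤ n) (hL : 2 ≤ L)
    {a b : ℝ} (hab : a < b)
    (ha : |a| ≤ min (1 / (8 * Real.exp 1 * (n : ℝ) * ((3 : ℝ) ^ d * (d : ℝ) ^ 2 + 1) ^ 2) / 8)
      ((1 / 2 : ℝ) * (1 / (8 * Real.exp 1 * (n : ℝ) * ((3 : ℝ) ^ d * (d : ℝ) ^ 2 + 1) ^ 2)) ^ 3 / 512))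
    (hb : |b| ≤ min (1 / (8 * Real.exp 1 * (n : ℝ) * ((3 : ℝ) ^ d * (d : ℝ) ^ 2 + 1) ^ 2) / 8)
      ((1 / 2 : ℝ) * (1 / (8 * Real.exp 1 * (n : ℝ) * ((3 : ℝ) ^ d * (d : ℝ) ^ 2 + 1) ^ 2)) ^ 3 / 512))
    {K : ℕ} (hK : 1 ≤ K)
    (κ : Kernel (Fin (K + 1) × GaugeConfig d L (Matrix.specialUnitaryGroup (Fin n) ℂ))
      (Fin (K + 1) × GaugeConfig d L (Matrix.specialUnitaryGroup (Fin n) ℂ))) [IsMarkovKernel κ]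
    (hinv : Kernel.Invariant κ (stTarget (fun U => -wilsonAction (StrongCoupling.defRep n) U)
      (trivialMeasure (Matrix.specialUnitaryGroup (Fin n) ℂ) d L) (fun k => a + k * ((b - a) / K)) K))
    (hnn : ∀ z, ∀ᵐ y ∂(κ z), |(((y.1 : Fin (K + 1)) : ℕ) : ℝ) - ((z.1 : Fin (K + 1)) : ℕ)| ≤ 1)
    (hup : ∀ (k : Fin (K + 1)) (U : GaugeConfig d L (Matrix.specialUnitaryGroup (Fin n) ℂ)), (k : ℕ) < K →
      (κ (k, U)).real {y | ((y.1 : Fin (K + 1)) : ℕ) = (k : ℕ) + 1} ≤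
        min 1 ((Real.exp ((a + (((k : ℕ) + 1 : ℕ) : ℝ) * ((b - a) / K)) *
              (-wilsonAction (StrongCoupling.defRep n) U)) /
            mgf (fun U => -wilsonAction (StrongCoupling.defRep n) U)
              (trivialMeasure (Matrix.specialUnitaryGroup (Fin n) ℂ) d L)
              (a + (((k : ℕ) + 1 : ℕ) : ℝ) * ((b - a) / K))) /
          (Real.exp ((a + ((k : ℕ) : ℝ) * ((b - a) / K)) * (-wilsonAction (StrongCoupling.defRep n) U)) /
            mgf (fun U => -wilsonAction (StrongCoupling.defRep n) U)
              (trivialMeasure (Matrix.specialUnitaryGroup (Fin n) ℂ) d L) (a + ((k : ℕ) : ℝ) * ((b - a) / K)))))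
    (hdown : ∀ (k : Fin (K + 1)) (U : GaugeConfig d L (Matrix.specialUnitaryGroup (Fin n) ℂ)), 1 ≤ (k : ℕ) →
      (κ (k, U)).real {y | ((y.1 : Fin (K + 1)) : ℕ) + 1 = (k : ℕ)} ≤
        min 1 ((Real.exp ((a + (((k : ℕ) - 1 : ℕ) : ℝ) * ((b - a) / K)) *
              (-wilsonAction (StrongCoupling.defRep n) U)) /
            mgf (fun U => -wilsonAction (StrongCoupling.defRep n) U)
              (trivialMeasure (Matrix.specialUnitaryGroup (Fin n) ℂ) d L)
              (a + (((k : ℕ) - 1 : ℕ) : ℝ) * ((b - a) / K))) /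
          (Real.exp ((a + ((k : ℕ) : ℝ) * ((b - a) / K)) * (-wilsonAction (StrongCoupling.defRep n) U)) /
            mgf (fun U => -wilsonAction (StrongCoupling.defRep n) U)
              (trivialMeasure (Matrix.specialUnitaryGroup (Fin n) ℂ) d L) (a + ((k : ℕ) : ℝ) * ((b - a) / K))))) :
    1 - 384 / (Real.exp 1 * Fintype.card (Plaquette d L) * (b - a) ^ 2) ≤
      (autocov κ (stTarget (fun U => -wilsonAction (StrongCoupling.defRep n) U)
            (trivialMeasure (Matrix.specialUnitaryGroup (Fin n) ℂ) d L) (fun k => a + k * ((b - a) / K)) K)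
          (fun z => (((z.1 : Fin (K + 1)) : ℕ) : ℝ)) 1 - ((K : ℝ) / 2) ^ 2) / (K * (K + 2) / 12) := by
  haveI : IsProbabilityMeasure (trivialMeasure (Matrix.specialUnitaryGroup (Fin n) ℂ) d L) :=
    trivialMeasure_isProbabilityMeasure
  have hρ : Continuous (StrongCoupling.defRep n) := continuous_subtype_val
  have hm2 := haarSqReTrace_eq_half hn
  -- a plaquette exists (`d ≥ 2`), so the floor `#plaq/4` is positive
  have hPpos : 0 < (Fintype.card (Plaquette d L) : ℝ) := by
    have : 0 < Fintype.card (Plaquette d L) :=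
      Fintype.card_pos_iff.2 ⟨((fun _ => 0), ⟨(⟨0, by omega⟩, ⟨1, by omega⟩), Fin.mk_lt_mk.2 zero_lt_one⟩)⟩
    exact_mod_cast this
  have hm0 : 0 < (1 / 2 : ℝ) * Fintype.card (Plaquette d L) / 2 := by positivity
  -- the strong-coupling floor on the window
  have hfloor : ∀ u ∈ Icc a b, (1 / 2 : ℝ) * Fintype.card (Plaquette d L) / 2 ≤
      variance (fun U => -wilsonAction (StrongCoupling.defRep n) U)
        ((trivialMeasure (Matrix.specialUnitaryGroup (Fin n) ℂ) d L).tilted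
          fun U => u * (-wilsonAction (StrongCoupling.defRep n) U)) := by
    intro u hu
    rw [tilted_neg_wilsonAction_eq (StrongCoupling.defRep n) hρ u, variance_fun_neg]
    have hu' : |u| ≤ min (1 / (8 * Real.exp 1 * (n : ℝ) * ((3 : ℝ) ^ d * (d : ℝ) ^ 2 + 1) ^ 2) / 8)
        ((1 / 2 : ℝ) * (1 / (8 * Real.exp 1 * (n : ℝ) * ((3 : ℝ) ^ d * (d : ℝ) ^ 2 + 1) ^ 2)) ^ 3 / 512) :=
      (abs_le_max_abs_abs hu.1 hu.2).trans (max_le ha hb)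
    rw [← hm2] at hu'
    have h := wilson_variance_ge_half_strongCoupling (d := d) (L := L) (by omega) hL u hu'
    rwa [hm2] at h
  have h := st_level_lagOneAutocorr_ge_kfree (μ := trivialMeasure (Matrix.specialUnitaryGroup (Fin n) ℂ) d L)
    (measurable_neg_wilsonAction (StrongCoupling.defRep n) hρ) (neg_wilsonAction_bounded (StrongCoupling.defRep n) hρ)
    hab hm0 hfloor hK κ hinv hnn hup hdown
  refine le_trans (le_of_eq ?_) h
  have e : (96 : ℝ) / (Real.exp 1 * ((1 / 2 : ℝ) * Fintype.card (Plaquette d L) / 2) * (b - a) ^ 2) =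
      384 / (Real.exp 1 * Fintype.card (Plaquette d L) * (b - a) ^ 2) := by
    rw [div_eq_div_iff ?_ ?_]
    · ring
    · have : (0 : ℝ) < (b - a) ^ 2 := by nlinarith
      positivity
    · have : (0 : ℝ) < (b - a) ^ 2 := by nlinarith
      positivity
  rw [e]

/-- **`SU(2)` AT STRONG COUPLING** (every `d ≥ 2`, `L ≥ 2`; window `a < b` with `|a|, |b| ≤ min(r/8, r³/512)`,
`r = 1/(16e·(3^d d² + 1)²)`; `K ≥ 1`): with `∫ (Re tr)² dHaar = 1` (`haarSqReTrace_su2`) the strong-coupling floor is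
`#plaq/2`, so for EVERY exact simulated-tempering kernel over the uniform ladder from `a` to `b`:
`1 − 192/(e·#plaq·(b−a)²) ≤ ρ_lev(1)`. [ours] -/
theorem wilson_st_level_lagOneAutocorr_ge_su2_strongCoupling (hd : 2 ≤ d) (hL : 2 ≤ L)
    {a b : ℝ} (hab : a < b)
    (ha : |a| ≤ min (1 / (8 * Real.exp 1 * (2 : ℝ) * ((3 : ℝ) ^ d * (d : ℝ) ^ 2 + 1) ^ 2) / 8)
      ((1 / (8 * Real.exp 1 * (2 : ℝ) * ((3 : ℝ) ^ d * (d : ℝ) ^ 2 + 1) ^ 2)) ^ 3 / 512))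
    (hb : |b| ≤ min (1 / (8 * Real.exp 1 * (2 : ℝ) * ((3 : ℝ) ^ d * (d : ℝ) ^ 2 + 1) ^ 2) / 8)
      ((1 / (8 * Real.exp 1 * (2 : ℝ) * ((3 : ℝ) ^ d * (d : ℝ) ^ 2 + 1) ^ 2)) ^ 3 / 512))
    {K : ℕ} (hK : 1 ≤ K)
    (κ : Kernel (Fin (K + 1) × GaugeConfig d L (Matrix.specialUnitaryGroup (Fin 2) ℂ))
      (Fin (K + 1) × GaugeConfig d L (Matrix.specialUnitaryGroup (Fin 2) ℂ))) [IsMarkovKernel κ]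
    (hinv : Kernel.Invariant κ (stTarget (fun U => -wilsonAction (StrongCoupling.defRep 2) U)
      (trivialMeasure (Matrix.specialUnitaryGroup (Fin 2) ℂ) d L) (fun k => a + k * ((b - a) / K)) K))
    (hnn : ∀ z, ∀ᵐ y ∂(κ z), |(((y.1 : Fin (K + 1)) : ℕ) : ℝ) - ((z.1 : Fin (K + 1)) : ℕ)| ≤ 1)
    (hup : ∀ (k : Fin (K + 1)) (U : GaugeConfig d L (Matrix.specialUnitaryGroup (Fin 2) ℂ)), (k : ℕ) < K →
      (κ (k, U)).real {y | ((y.1 : Fin (K + 1)) : ℕ) = (k : ℕ) + 1} ≤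
        min 1 ((Real.exp ((a + (((k : ℕ) + 1 : ℕ) : ℝ) * ((b - a) / K)) *
              (-wilsonAction (StrongCoupling.defRep 2) U)) /
            mgf (fun U => -wilsonAction (StrongCoupling.defRep 2) U)
              (trivialMeasure (Matrix.specialUnitaryGroup (Fin 2) ℂ) d L)
              (a + (((k : ℕ) + 1 : ℕ) : ℝ) * ((b - a) / K))) /
          (Real.exp ((a + ((k : ℕ) : ℝ) * ((b - a) / K)) * (-wilsonAction (StrongCoupling.defRep 2) U)) /
            mgf (fun U => -wilsonAction (StrongCoupling.defRep 2) U)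
              (trivialMeasure (Matrix.specialUnitaryGroup (Fin 2) ℂ) d L) (a + ((k : ℕ) : ℝ) * ((b - a) / K)))))
    (hdown : ∀ (k : Fin (K + 1)) (U : GaugeConfig d L (Matrix.specialUnitaryGroup (Fin 2) ℂ)), 1 ≤ (k : ℕ) →
      (κ (k, U)).real {y | ((y.1 : Fin (K + 1)) : ℕ) + 1 = (k : ℕ)} ≤
        min 1 ((Real.exp ((a + (((k : ℕ) - 1 : ℕ) : ℝ) * ((b - a) / K)) *
              (-wilsonAction (StrongCoupling.defRep 2) U)) /
            mgf (fun U => -wilsonAction (StrongCoupling.defRep 2) U)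
              (trivialMeasure (Matrix.specialUnitaryGroup (Fin 2) ℂ) d L)
              (a + (((k : ℕ) - 1 : ℕ) : ℝ) * ((b - a) / K))) /
          (Real.exp ((a + ((k : ℕ) : ℝ) * ((b - a) / K)) * (-wilsonAction (StrongCoupling.defRep 2) U)) /
            mgf (fun U => -wilsonAction (StrongCoupling.defRep 2) U)
              (trivialMeasure (Matrix.specialUnitaryGroup (Fin 2) ℂ) d L) (a + ((k : ℕ) : ℝ) * ((b - a) / K))))) :
    1 - 192 / (Real.exp 1 * Fintype.card (Plaquette d L) * (b - a) ^ 2) ≤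
      (autocov κ (stTarget (fun U => -wilsonAction (StrongCoupling.defRep 2) U)
            (trivialMeasure (Matrix.specialUnitaryGroup (Fin 2) ℂ) d L) (fun k => a + k * ((b - a) / K)) K)
          (fun z => (((z.1 : Fin (K + 1)) : ℕ) : ℝ)) 1 - ((K : ℝ) / 2) ^ 2) / (K * (K + 2) / 12) := by
  haveI : IsProbabilityMeasure (trivialMeasure (Matrix.specialUnitaryGroup (Fin 2) ℂ) d L) :=
    trivialMeasure_isProbabilityMeasure
  have hρ : Continuous (StrongCoupling.defRep 2) := continuous_subtype_val
  have hm2 := haarSqReTrace_su2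
  have hPpos : 0 < (Fintype.card (Plaquette d L) : ℝ) := by
    have : 0 < Fintype.card (Plaquette d L) :=
      Fintype.card_pos_iff.2 ⟨((fun _ => 0), ⟨(⟨0, by omega⟩, ⟨1, by omega⟩), Fin.mk_lt_mk.2 zero_lt_one⟩)⟩
    exact_mod_cast this
  have hm0 : 0 < (1 : ℝ) * Fintype.card (Plaquette d L) / 2 := by positivity
  have e512 : (∫ g, ((g : Matrix (Fin 2) (Fin 2) ℂ)).trace.re ^ 2
      ∂(haarProbability (Matrix.specialUnitaryGroup (Fin 2) ℂ))) *
      (1 / (8 * Real.exp 1 * ((2 : ℕ) : ℝ) * ((3 : ℝ) ^ d * (d : ℝ) ^ 2 + 1) ^ 2)) ^ 3 / 512 =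
      (1 / (8 * Real.exp 1 * (2 : ℝ) * ((3 : ℝ) ^ d * (d : ℝ) ^ 2 + 1) ^ 2)) ^ 3 / 512 := by
    rw [hm2, one_mul]; norm_num
  have e8 : (1 / (8 * Real.exp 1 * ((2 : ℕ) : ℝ) * ((3 : ℝ) ^ d * (d : ℝ) ^ 2 + 1) ^ 2) / 8) =
      1 / (8 * Real.exp 1 * (2 : ℝ) * ((3 : ℝ) ^ d * (d : ℝ) ^ 2 + 1) ^ 2) / 8 := by norm_num
  have hfloor : ∀ u ∈ Icc a b, (1 : ℝ) * Fintype.card (Plaquette d L) / 2 ≤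
      variance (fun U => -wilsonAction (StrongCoupling.defRep 2) U)
        ((trivialMeasure (Matrix.specialUnitaryGroup (Fin 2) ℂ) d L).tilted
          fun U => u * (-wilsonAction (StrongCoupling.defRep 2) U)) := by
    intro u hu
    rw [tilted_neg_wilsonAction_eq (StrongCoupling.defRep 2) hρ u, variance_fun_neg]
    have hu' : |u| ≤ min (1 / (8 * Real.exp 1 * (2 : ℝ) * ((3 : ℝ) ^ d * (d : ℝ) ^ 2 + 1) ^ 2) / 8)
        ((1 / (8 * Real.exp 1 * (2 : ℝ) * ((3 : ℝ) ^ d * (d : ℝ) ^ 2 + 1) ^ 2)) ^ 3 / 512) :=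
      (abs_le_max_abs_abs hu.1 hu.2).trans (max_le ha hb)
    have h := wilson_variance_ge_half_strongCoupling (d := d) (L := L) (n := 2) le_rfl hL u
      (by rw [e8, e512]; exact hu')
    rwa [hm2] at h
  have h := st_level_lagOneAutocorr_ge_kfree (μ := trivialMeasure (Matrix.specialUnitaryGroup (Fin 2) ℂ) d L)
    (measurable_neg_wilsonAction (StrongCoupling.defRep 2) hρ) (neg_wilsonAction_bounded (StrongCoupling.defRep 2) hρ)
    hab hm0 hfloor hK κ hinv hnn hup hdown
  refine le_trans (le_of_eq ?_) h
  have e : (96 : ℝ) / (Real.exp 1 * ((1 : ℝ) * Fintype.card (Plaquette d L) / 2) * (b - a) ^ 2) =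
      192 / (Real.exp 1 * Fintype.card (Plaquette d L) * (b - a) ^ 2) := by
    rw [div_eq_div_iff ?_ ?_]
    · ring
    · have : (0 : ℝ) < (b - a) ^ 2 := by nlinarith
      positivity
    · have : (0 : ℝ) < (b - a) ^ 2 := by nlinarith
      positivity
  rw [e]

end SUN

/-! ## §3 Tempering in the BOUNDARY CONDITION (the defect coupling), every compact gauge group, every bulk coupling -/

section Defect

variable {d L N : ℕ} [NeZero L] {G : Type*} [Group G] [TopologicalSpace G] [IsTopologicalGroup G]
  [CompactSpace G] [MeasurableSpace G] [BorelSpace G] [SecondCountableTopology G]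
  (ρ : G →* Matrix (Fin N) (Fin N) ℂ)

/-- **SIMULATED TEMPERING IN THE BOUNDARY CONDITION IS DIFFUSIVE IN THE DEFECT SIZE** (every compact `G`,
continuous `ρ` with `Var_Haar(Re tr ρ) > 0`, `L ≥ 2`, a non-empty finite set `D` of plaquettes, bulk coupling
`|β| ≤ B`, defect-coupling window `−B ≤ a < b ≤ B`, `K ≥ 1`).  The defect family
`μ_{β,u} ∝ exp(−βS_{Dᶜ} − uS_D) dU` of the boundary-condition-tempering samplers (Hasenbusch 2017; the
single-copy variant of Bonanno–Bonati–D'Elia's PTBC) is the exponential family `ν_β.tilted(u·(−S_D))`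
(`Scaling/DefectSwapAcceptance`); with lean-1's defect specific-heat floor
`m_D = e^{−8N(d−1)B}·(#D/(8d(d−1)+1))·Var_Haar(Re tr ρ)` (`defect_floor_family`), for EVERY Markov kernel on
`Fin (K+1) × G^E` leaving the exact-weight simulated-tempering target over the uniform defect-coupling ladder
from `a` to `b` invariant, with nearest-neighbour Metropolis-dominated level moves:
`1 − 96/(e·m_D·(b−a)²) ≤ ρ_lev(1)` — `Ω(#D·(b−a)²)` level updates per decorrelation of the boundary condition,
for every number of levels and every within-level algorithm. [ours] -/
theorem defect_st_level_lagOneAutocorr_ge (hL : 2 ≤ L) (hρ : Continuous ρ)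
    (hv : 0 < variance (fun g : G => (ρ g).trace.re) (haarProbability G)) (D : Finset (Plaquette d L))
    (hD : 0 < D.card) {β B a b : ℝ} (hβ : |β| ≤ B) (ha : -B ≤ a) (hab : a < b) (hb : b ≤ B)
    {K : ℕ} (hK : 1 ≤ K)
    (κ : Kernel (Fin (K + 1) × GaugeConfig d L G) (Fin (K + 1) × GaugeConfig d L G)) [IsMarkovKernel κ]
    (hinv : Kernel.Invariant κ (stTarget
      (fun U : GaugeConfig d L G => -(∑ p ∈ D, ((N : ℝ) - (ρ (plaquetteHolonomy U p.1 p.2.1.1 p.2.1.2)).trace.re)))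
      ((Measure.pi fun _ : Edge d L => haarProbability G).tilted fun U =>
        -(β * ∑ p ∈ Dᶜ, ((N : ℝ) - (ρ (plaquetteHolonomy U p.1 p.2.1.1 p.2.1.2)).trace.re)))
      (fun k => a + k * ((b - a) / K)) K))
    (hnn : ∀ z, ∀ᵐ y ∂(κ z), |(((y.1 : Fin (K + 1)) : ℕ) : ℝ) - ((z.1 : Fin (K + 1)) : ℕ)| ≤ 1)
    (hup : ∀ (k : Fin (K + 1)) (U : GaugeConfig d L G), (k : ℕ) < K →
      (κ (k, U)).real {y | ((y.1 : Fin (K + 1)) : ℕ) = (k : ℕ) + 1} ≤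
        min 1 ((Real.exp ((a + (((k : ℕ) + 1 : ℕ) : ℝ) * ((b - a) / K)) *
              (-(∑ p ∈ D, ((N : ℝ) - (ρ (plaquetteHolonomy U p.1 p.2.1.1 p.2.1.2)).trace.re)))) /
            mgf (fun U : GaugeConfig d L G =>
                -(∑ p ∈ D, ((N : ℝ) - (ρ (plaquetteHolonomy U p.1 p.2.1.1 p.2.1.2)).trace.re)))
              ((Measure.pi fun _ : Edge d L => haarProbability G).tilted fun U =>
                -(β * ∑ p ∈ Dᶜ, ((N : ℝ) - (ρ (plaquetteHolonomy U p.1 p.2.1.1 p.2.1.2)).trace.re)))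
              (a + (((k : ℕ) + 1 : ℕ) : ℝ) * ((b - a) / K))) /
          (Real.exp ((a + ((k : ℕ) : ℝ) * ((b - a) / K)) *
              (-(∑ p ∈ D, ((N : ℝ) - (ρ (plaquetteHolonomy U p.1 p.2.1.1 p.2.1.2)).trace.re)))) /
            mgf (fun U : GaugeConfig d L G =>
                -(∑ p ∈ D, ((N : ℝ) - (ρ (plaquetteHolonomy U p.1 p.2.1.1 p.2.1.2)).trace.re)))
              ((Measure.pi fun _ : Edge d L => haarProbability G).tilted fun U =>
                -(β * ∑ p ∈ Dᶜ, ((N : ℝ) - (ρ (plaquetteHolonomy U p.1 p.2.1.1 p.2.1.2)).trace.re)))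
              (a + ((k : ℕ) : ℝ) * ((b - a) / K)))))
    (hdown : ∀ (k : Fin (K + 1)) (U : GaugeConfig d L G), 1 ≤ (k : ℕ) →
      (κ (k, U)).real {y | ((y.1 : Fin (K + 1)) : ℕ) + 1 = (k : ℕ)} ≤
        min 1 ((Real.exp ((a + (((k : ℕ) - 1 : ℕ) : ℝ) * ((b - a) / K)) *
              (-(∑ p ∈ D, ((N : ℝ) - (ρ (plaquetteHolonomy U p.1 p.2.1.1 p.2.1.2)).trace.re)))) /
            mgf (fun U : GaugeConfig d L G =>
                -(∑ p ∈ D, ((N : ℝ) - (ρ (plaquetteHolonomy U p.1 p.2.1.1 p.2.1.2)).trace.re)))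
              ((Measure.pi fun _ : Edge d L => haarProbability G).tilted fun U =>
                -(β * ∑ p ∈ Dᶜ, ((N : ℝ) - (ρ (plaquetteHolonomy U p.1 p.2.1.1 p.2.1.2)).trace.re)))
              (a + (((k : ℕ) - 1 : ℕ) : ℝ) * ((b - a) / K))) /
          (Real.exp ((a + ((k : ℕ) : ℝ) * ((b - a) / K)) *
              (-(∑ p ∈ D, ((N : ℝ) - (ρ (plaquetteHolonomy U p.1 p.2.1.1 p.2.1.2)).trace.re)))) /
            mgf (fun U : GaugeConfig d L G =>
                -(∑ p ∈ D, ((N : ℝ) - (ρ (plaquetteHolonomy U p.1 p.2.1.1 p.2.1.2)).trace.re)))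
              ((Measure.pi fun _ : Edge d L => haarProbability G).tilted fun U =>
                -(β * ∑ p ∈ Dᶜ, ((N : ℝ) - (ρ (plaquetteHolonomy U p.1 p.2.1.1 p.2.1.2)).trace.re)))
              (a + ((k : ℕ) : ℝ) * ((b - a) / K))))) :
    1 - 96 / (Real.exp 1 * (Real.exp (-(8 * N * ((d - 1 : ℕ) : ℝ) * B)) *
        ((D.card : ℝ) / ((8 * d * (d - 1) + 1 : ℕ) : ℝ)) *
          variance (fun g : G => (ρ g).trace.re) (haarProbability G)) * (b - a) ^ 2) ≤
      (autocov κ (stTarget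
            (fun U : GaugeConfig d L G =>
              -(∑ p ∈ D, ((N : ℝ) - (ρ (plaquetteHolonomy U p.1 p.2.1.1 p.2.1.2)).trace.re)))
            ((Measure.pi fun _ : Edge d L => haarProbability G).tilted fun U =>
              -(β * ∑ p ∈ Dᶜ, ((N : ℝ) - (ρ (plaquetteHolonomy U p.1 p.2.1.1 p.2.1.2)).trace.re)))
            (fun k => a + k * ((b - a) / K)) K)
          (fun z => (((z.1 : Fin (K + 1)) : ℕ) : ℝ)) 1 - ((K : ℝ) / 2) ^ 2) / (K * (K + 2) / 12) := by
  haveI := isProbabilityMeasure_defectBase (d := d) (L := L) ρ hρ β D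
  have hm0 : 0 < Real.exp (-(8 * N * ((d - 1 : ℕ) : ℝ) * B)) *
      ((D.card : ℝ) / ((8 * d * (d - 1) + 1 : ℕ) : ℝ)) * variance (fun g : G => (ρ g).trace.re) (haarProbability G) := by
    have hDr : (0 : ℝ) < D.card := by exact_mod_cast hD
    have hden : (0 : ℝ) < ((8 * d * (d - 1) + 1 : ℕ) : ℝ) := by positivity
    exact mul_pos (mul_pos (Real.exp_pos _) (div_pos hDr hden)) hv
  have hfloor : ∀ u ∈ Icc a b, Real.exp (-(8 * N * ((d - 1 : ℕ) : ℝ) * B)) *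
      ((D.card : ℝ) / ((8 * d * (d - 1) + 1 : ℕ) : ℝ)) * variance (fun g : G => (ρ g).trace.re) (haarProbability G) ≤
      variance (fun U : GaugeConfig d L G =>
          -(∑ p ∈ D, ((N : ℝ) - (ρ (plaquetteHolonomy U p.1 p.2.1.1 p.2.1.2)).trace.re)))
        ((((Measure.pi fun _ : Edge d L => haarProbability G).tilted fun U =>
          -(β * ∑ p ∈ Dᶜ, ((N : ℝ) - (ρ (plaquetteHolonomy U p.1 p.2.1.1 p.2.1.2)).trace.re))).tilted
          fun U => u * (-(∑ p ∈ D, ((N : ℝ) - (ρ (plaquetteHolonomy U p.1 p.2.1.1 p.2.1.2)).trace.re))))) :=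
    fun u hu => defect_floor_family (d := d) (L := L) ρ hL hρ hβ
      (abs_le.2 ⟨by linarith [hu.1], by linarith [hu.2]⟩) D
  exact st_level_lagOneAutocorr_ge_kfree (measurable_neg_defectSum ρ hρ D) (neg_defectSum_bounded ρ hρ D)
    hab hm0 hfloor hK κ hinv hnn hup hdown

end Defect

end Summit.Ventures.LatticeQCDFlow.Scaling

end
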